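import Mathlib
import Summits.Ventures.HodgeRepro.Tier4.Target
import Summits.Ventures.HodgeRepro.Tier4.Line3.Defs
import Summits.Ventures.HodgeRepro.Tier4.Line3.DefsLemmas
import Summits.Ventures.HodgeRepro.Tier4.Line3.LocaliserS
import Summits.Ventures.HodgeRepro.Tier4.Line3.ClassBoundGauss
import Summits.Ventures.HodgeRepro.Tier4.Line3.DefiniteBound
import Summits.Ventures.HodgeRepro.Tier4.Line3.InvariantMajorantDef
import Summits.Ventures.HodgeRepro.Tier4.Line3.InvariantClassBound
import Summits.Ventures.HodgeRepro.Tier4.Line3.GrowthInvOfGauss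
import Summits.Ventures.HodgeRepro.Tier4.Line3.InvariantRouteFinal

/-!
# Tier4/Line3/GrowthInvOfMajorant — the invariant growth clause from a majorant of the THETA COEFFICIENTS

Blind re-derivation cell `pub-hodge-repro`, Tier 4 «PROVE THE STEP» (README §9–§10), LINE L3, lemma L3.5
`term_dominated`; seat t4-L2-p3 (gen 3), successor of the invariant-majorant route (g2: `term_dominated_skel`,
p675078) and of t4-L2-p1's reduction `growthInv_of_gaussGrowth` (p675191).

THE QUESTION LEFT BY THE ROUTE (crit-2 S13207 (3)): the interface clause `GrowthInv` is a statement about the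
LOCALISER's coefficient function `coefQ D.cf (ℓ.loc N)` at every `Γ⁴`-translate of the slots — it mixes the
construction of the localiser (L3.3) with the printed theta data (L3.0).  THIS MODULE SEPARATES THE TWO and proves
the only part that is mechanics: the Hecke action.

* `heckeSize h = Σ_terms |n_t| · |R_t|` is the ℓ¹-size of a Hecke element (the number of translates with
  multiplicity), `trSize γ = Σ_h ‖a_h‖ ∏_k heckeSize (h_k)` that of a `ℂ`-combination of quadruples;
  `LocSize ℓ` says the localiser's size at depth `N` is `≤ B q₂^N` (a depth-`N` Hecke operator at `𝔭` has
  `N(𝔭)^{O(N)}` cosets) — a clause on the LOCALISER alone.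
* `HasCoefMajorant D ℓ`: a non-negative function `m` on `V(E′)` with `‖cf j x‖ ≤ C · m x`, `Γ`-INVARIANT,
  moved by the representatives of the depth-`N` localiser by at most `q₃^N` (the `𝔭`-adic depth of the
  representatives), and of polynomial–Gaussian size `m x ≤ (1 + ‖y(x)‖)^e gaussDefAt c₁ x` — a clause on the THETA
  DATA alone (the print's «coefficient = torus average × Gaussian ≤ content × Gaussian»: the content ideal is
  `Γ`-invariant, grows by `N(𝔭)^{O(N)}` under a `𝔭`-adic representative, and its norm is bounded by the archimedean
  sizes of a coordinate, the definite ones absorbed by the Gaussian).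
* **`growthInv_of_coefMajorant`**: `LocSize ℓ → HasCoefMajorant D ℓ → GrowthInv D p L₀ xm ℓ`.  Mechanism:
  `‖heckeAct h c x‖ ≤ heckeSize h · sup_r ‖c (r x)‖` (`norm_heckeAct_le`), `m (r x) ≤ q₃^N m x` at every
  representative `r` of the localiser, `m (x) = m (g x)` for `g ∈ Γ`, and at a definite embedding the
  sizes of `x` and of a unitary translate `γ x` are comparable in BOTH directions (`exists_comparability_rev`,
  the reverse of t4-L2-p1's `exists_comparability`), so half of the Gaussian `gaussDefAt c₁ (g x)` is read back at
  `x` (`gaussDefAt_mulVec_le`), giving the shape `quadMaj e c₀ x g · ∏ gaussDefAt c₀ (x k)` with `c₀ = c₁ / (2R)`.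
  Constants: `B = B_size · C⁴`, `q₂ = q_size · q₃⁴`, the exponent `e` unchanged.
* `term_dominated_of_coefMajorant_lit`: L3.5's conclusion from `LocSize`, `HasCoefMajorant` and `hlit`, through
  the invariant route's `term_dominated_of_growthInv_lit` (InvariantRouteFinal, p674963).

No printed input is consumed; nothing here asserts anything about the truth of (P); HC_CM is NOT proved by anyone
in this repository.
-/

set_option autoImplicit false

noncomputable section

namespace Summit.Ventures.HodgeRepro.Tier4.Line3

open Summit.Ventures.HodgeRepro.Tier4
open Matrix NumberField
open scoped ComplexConjugate

/-! ### 1. The ℓ¹-size of a Hecke element and the norm of the Hecke action -/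

section HeckeSize

variable {E : Type} [Field E]

/-- The ℓ¹-size `Σ_terms |n_t| · |R_t|` of a Hecke element: the number of translates, with multiplicity. -/
def heckeSize (h : HeckeElement E) : ℝ := (h.terms.map fun t => ‖(t.1 : ℝ)‖ * (t.2.card : ℝ)).sum

/-- `0 ≤ heckeSize`. -/
theorem heckeSize_nonneg (h : HeckeElement E) : 0 ≤ heckeSize h := by
  unfold heckeSize
  refine List.sum_nonneg fun y hy => ?_
  rw [List.mem_map] at hy
  obtain ⟨t, _, rfl⟩ := hy
  positivity

/-- The norm of a list sum is bounded by a termwise majorant. -/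
theorem norm_list_sum_le_of_le {ι : Type} (l : List ι) (f : ι → ℂ) (g : ι → ℝ)
    (hfg : ∀ t ∈ l, ‖f t‖ ≤ g t) : ‖(l.map f).sum‖ ≤ (l.map g).sum := by
  induction l with
  | nil => simp
  | cons a l ih =>
    simp only [List.map_cons, List.sum_cons]
    exact (norm_add_le _ _).trans (add_le_add (hfg a List.mem_cons_self)
      (ih fun t ht => hfg t (List.mem_cons_of_mem _ ht)))

end HeckeSize

namespace T4Data

variable (X : T4Data)

/-- **The Hecke action is bounded by the ℓ¹-size times the largest value on the translates**: if
`‖c (r x)‖ ≤ M` for every representative `r` of every term of `h`, then `‖(h · c)(x)‖ ≤ heckeSize h · M`. -/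
theorem norm_heckeAct_le (h : HeckeElement X.E) (c : (Fin 3 → X.E) → ℂ) (x : Fin 3 → X.E) {M : ℝ}
    (hM : ∀ t ∈ h.terms, ∀ r ∈ t.2, ‖c (r *ᵥ x)‖ ≤ M) :
    ‖X.heckeAct h c x‖ ≤ heckeSize h * M := by
  unfold heckeAct heckeSize
  have hterm : ∀ t ∈ h.terms, ‖t.1 • t.2.sum (fun r => c (r *ᵥ x))‖ ≤
      ‖(t.1 : ℝ)‖ * (t.2.card : ℝ) * M := by
    intro t ht
    rw [norm_zsmul ℝ, mul_assoc]
    refine mul_le_mul_of_nonneg_left ?_ (norm_nonneg _)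
    refine (norm_sum_le _ _).trans ?_
    have := Finset.sum_le_card_nsmul t.2 (fun r => ‖c (r *ᵥ x)‖) M (fun r hr => hM t ht r hr)
    rwa [nsmul_eq_mul] at this
  refine (norm_list_sum_le_of_le _ _ _ hterm).trans ?_
  rw [List.sum_map_mul_right]

/-! ### 2. Reverse comparability at the definite embeddings and the Gaussian of a unitary translate -/

/-- **Reverse comparability at one embedding**: at a definite embedding `σ` (and trivially at the others), there is
`R ≥ 1` with `Σ_i ‖σ x_i‖² ≤ R · Σ_i ‖σ (γx)_i‖²` for every `γ ∈ U(H)(E′)` and every `x` — the reverse of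
t4-L2-p1's `exists_comparability`, by the same two bounds read in the other order: `lam Σ‖σ x_i‖² ≤ ‖σ ⟨x,x⟩_H‖ =
‖σ ⟨γx,γx⟩_H‖ ≤ 2K Σ‖σ (γx)_i‖²`. -/
theorem exists_comparability_rev (σ : X.E →+* ℂ) :
    ∃ R : ℝ, 1 ≤ R ∧ (σ ≠ X.τ₀ → σ ≠ conjEmb X.τ₀ →
      ∀ γ : Matrix (Fin 3) (Fin 3) X.E, IsUnitaryOf X.c X.H γ → ∀ x : Fin 3 → X.E,
        ∑ i, ‖σ (x i)‖ ^ 2 ≤ R * ∑ i, ‖σ ((γ *ᵥ x) i)‖ ^ 2) := by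
  by_cases hdef : σ ≠ X.τ₀ ∧ σ ≠ conjEmb X.τ₀
  · obtain ⟨hσ, hσ'⟩ := hdef
    have hσc : ∀ t, ‖σ (X.c t)‖ = ‖σ t‖ := fun t => by rw [X.emb_c_eq_conj, Complex.norm_conj]
    have hD := X.hDef σ hσ hσ'
    have hlow : ∃ lam : ℝ, 0 < lam ∧ ∀ v : Fin 3 → ℂ,
        lam * ∑ i, ‖v i‖ ^ 2 ≤ ‖star v ⬝ᵥ ((X.H.map σ) *ᵥ v)‖ := by
      rcases hD with hpos | hneg
      · obtain ⟨lam, hlam, h⟩ := exists_pos_mul_sum_norm_sq_le_re_dotProduct_mulVec hpos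
        exact ⟨lam, hlam, fun v => (h v).trans (Complex.re_le_norm _)⟩
      · obtain ⟨lam, hlam, h⟩ := exists_pos_mul_sum_norm_sq_le_re_dotProduct_mulVec hneg
        refine ⟨lam, hlam, fun v => ?_⟩
        calc lam * ∑ i, ‖v i‖ ^ 2 ≤ (star v ⬝ᵥ ((-(X.H.map σ)) *ᵥ v)).re := h v
          _ = (-(star v ⬝ᵥ ((X.H.map σ) *ᵥ v))).re := by rw [Matrix.neg_mulVec, dotProduct_neg]
          _ ≤ ‖-(star v ⬝ᵥ ((X.H.map σ) *ᵥ v))‖ := Complex.re_le_norm _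
          _ = ‖star v ⬝ᵥ ((X.H.map σ) *ᵥ v)‖ := norm_neg _
    obtain ⟨lam, hlam, hlow⟩ := hlow
    set K : ℝ := ∑ k, ∑ l, ‖σ (X.H k l)‖ with hK
    refine ⟨max 1 (2 * K / lam), le_max_left _ _, fun _ _ γ hγ x => ?_⟩
    have hform_eq : hform X.c X.H (γ *ᵥ x) (γ *ᵥ x) = hform X.c X.H x x := X.hform_unitary hγ x x
    have h1 : lam * ∑ i, ‖σ (x i)‖ ^ 2 ≤ ‖σ (hform X.c X.H x x)‖ := by
      rw [X.map_hform_eq_dotProduct]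
      exact hlow _
    have h2 : ‖σ (hform X.c X.H x x)‖ ≤ K * (2 * ∑ i, ‖σ ((γ *ᵥ x) i)‖ ^ 2) := by
      have := norm_map_hform_le X.c X.H σ hσc (γ *ᵥ x) (γ *ᵥ x)
      rw [hform_eq] at this
      rw [hK]
      linarith [this]
    have hK0 : 0 ≤ K := Finset.sum_nonneg fun _ _ => Finset.sum_nonneg fun _ _ => norm_nonneg _
    have hsum0 : 0 ≤ ∑ i, ‖σ ((γ *ᵥ x) i)‖ ^ 2 := Finset.sum_nonneg fun _ _ => by positivity
    calc ∑ i, ‖σ (x i)‖ ^ 2 = (lam * ∑ i, ‖σ (x i)‖ ^ 2) / lam := by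
          field_simp
      _ ≤ (K * (2 * ∑ i, ‖σ ((γ *ᵥ x) i)‖ ^ 2)) / lam :=
          div_le_div_of_nonneg_right (h1.trans h2) hlam.le
      _ = (2 * K / lam) * ∑ i, ‖σ ((γ *ᵥ x) i)‖ ^ 2 := by
          field_simp
      _ ≤ max 1 (2 * K / lam) * ∑ i, ‖σ ((γ *ᵥ x) i)‖ ^ 2 :=
          mul_le_mul_of_nonneg_right (le_max_right _ _) hsum0
  · refine ⟨1, le_rfl, fun hσ hσ' => absurd ⟨hσ, hσ'⟩ hdef⟩

/-- **Uniform reverse comparability**: one `R ≥ 1` for all definite embeddings, all `γ ∈ U(H)(E′)`, all `x`. -/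
theorem exists_uniform_comparability_rev :
    ∃ R : ℝ, 1 ≤ R ∧ ∀ σ : X.E →+* ℂ, σ ≠ X.τ₀ → σ ≠ conjEmb X.τ₀ →
      ∀ γ : Matrix (Fin 3) (Fin 3) X.E, IsUnitaryOf X.c X.H γ → ∀ x : Fin 3 → X.E,
        ∑ i, ‖σ (x i)‖ ^ 2 ≤ R * ∑ i, ‖σ ((γ *ᵥ x) i)‖ ^ 2 := by
  choose R hR1 hR using X.exists_comparability_rev
  obtain ⟨σ₀⟩ : Nonempty (X.E →+* ℂ) := inferInstance
  have hR0 : ∀ σ, 0 ≤ R σ := fun σ => zero_le_one.trans (hR1 σ)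
  have hle : ∀ σ, R σ ≤ ∑ σ' : X.E →+* ℂ, R σ' := fun σ =>
    Finset.single_le_sum (f := R) (fun σ' _ => hR0 σ') (Finset.mem_univ σ)
  refine ⟨∑ σ' : X.E →+* ℂ, R σ', (hR1 σ₀).trans (hle σ₀), fun σ hσ hσ' γ hγ x => ?_⟩
  have hsum0 : 0 ≤ ∑ i, ‖σ ((γ *ᵥ x) i)‖ ^ 2 := Finset.sum_nonneg fun _ _ => by positivity
  exact (hR σ hσ hσ' γ hγ x).trans (mul_le_mul_of_nonneg_right (hle σ) hsum0)

/-- **The Gaussian of a unitary translate is read back at the point**: with `R` the uniform reverse comparability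
constant and `c ≥ 0`, `gaussDefAt c (γ x) ≤ gaussDefAt (c / R) x` for every `γ ∈ U(H)(E′)`. -/
theorem gaussDefAt_mulVec_le {R : ℝ} (hRpos : 0 < R)
    (hR : ∀ σ : X.E →+* ℂ, σ ≠ X.τ₀ → σ ≠ conjEmb X.τ₀ →
      ∀ γ : Matrix (Fin 3) (Fin 3) X.E, IsUnitaryOf X.c X.H γ → ∀ x : Fin 3 → X.E,
        ∑ i, ‖σ (x i)‖ ^ 2 ≤ R * ∑ i, ‖σ ((γ *ᵥ x) i)‖ ^ 2)
    {c : ℝ} (hc : 0 ≤ c) {γ : Matrix (Fin 3) (Fin 3) X.E} (hγ : IsUnitaryOf X.c X.H γ) (x : Fin 3 → X.E) :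
    X.gaussDefAt c (γ *ᵥ x) ≤ X.gaussDefAt (c / R) x := by
  classical
  rw [X.gaussDefAt_eq_prod, X.gaussDefAt_eq_prod]
  refine Finset.prod_le_prod (fun σ _ => (Real.exp_pos _).le) fun σ hσ => ?_
  rw [Finset.mem_filter] at hσ
  apply Real.exp_le_exp.mpr
  have h := hR σ hσ.2.1 hσ.2.2 γ hγ x
  have hcR : 0 ≤ c / R := div_nonneg hc hRpos.le
  have h' := mul_le_mul_of_nonneg_left h hcR
  rw [← mul_assoc, div_mul_cancel₀ c hRpos.ne'] at h'
  linarith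

/-! ### 3. The size of a localiser and a majorant of the theta coefficients (the two clauses) -/

/-- The ℓ¹-size of a `ℂ`-combination of Hecke quadruples: `Σ_h ‖a_h‖ · ∏_k heckeSize (h at slot k)`. -/
def trSize {K : X.Level} (γ : X.Tr K) : ℝ :=
  γ.sum fun h a => ‖a‖ * (heckeSize (h.1 (X.slot 0)) * heckeSize (h.1 (X.slot 1)) *
    (heckeSize (h.1 (X.slot 2)) * heckeSize (h.1 (X.slot 3))))

/-- `r` is a coset representative occurring in the combination `γ`: in some term of some slot of some quadruple of
its support. -/
def IsRepOf {K : X.Level} (γ : X.Tr K) (r : Matrix (Fin 3) (Fin 3) X.E) : Prop :=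
  ∃ h ∈ γ.support, ∃ k : Fin 4, ∃ t ∈ (h.1 (X.slot k)).terms, r ∈ t.2

/-- **THE SIZE CLAUSE OF A LOCALISER** (a clause on the localiser alone): its ℓ¹-size at depth `N` is at most
`B q₂^N` — the number of Hecke translates of a depth-`N` combination at `𝔭` is `N(𝔭)^{O(N)}`. -/
def LocSize (D : X.ThetaData) {p : IsDedekindDomain.HeightOneSpectrum (RingOfIntegers X.E)}
    {L₀ : Submodule (RingOfIntegers X.E) (Fin 3 → X.E)} {xm : X.Tuple} (ℓ : X.LocS D p L₀ xm) : Prop :=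
  ∃ B q₂ : ℝ, 0 ≤ B ∧ 0 ≤ q₂ ∧ ∀ N, X.trSize (ℓ.loc N) ≤ B * q₂ ^ N

/-- **A MAJORANT OF THE THETA COEFFICIENTS** (a clause on the theta data, with the `𝔭`-adic depth of the
localiser's representatives): a non-negative `m` on `V(E′)` with `‖cf j x‖ ≤ C · m x`, `Γ`-invariant, moved by
every representative of the depth-`N` localiser by at most the factor `q₃^N`, and of polynomial–Gaussian size
`m x ≤ (1 + ‖y(x)‖)^e · gaussDefAt c₁ x`. -/
def HasCoefMajorant (D : X.ThetaData) {p : IsDedekindDomain.HeightOneSpectrum (RingOfIntegers X.E)}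
    {L₀ : Submodule (RingOfIntegers X.E) (Fin 3 → X.E)} {xm : X.Tuple} (ℓ : X.LocS D p L₀ xm) : Prop :=
  ∃ (m : (Fin 3 → X.E) → ℝ) (C q₃ e c₁ : ℝ), 0 ≤ C ∧ 0 ≤ q₃ ∧ 0 < c₁ ∧
    (∀ x, 0 ≤ m x) ∧
    (∀ j x, ‖D.cf j x‖ ≤ C * m x) ∧
    (∀ γ ∈ X.Γ, ∀ x, m (γ *ᵥ x) = m x) ∧
    (∀ N r, X.IsRepOf (ℓ.loc N) r → ∀ x, m (r *ᵥ x) ≤ q₃ ^ N * m x) ∧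
    (∀ x, m x ≤ (1 + ‖X.ballCoord x‖) ^ e * X.gaussDefAt c₁ x)

/-! ### 4. The slot bound and the reduction -/

/-- **The slot bound**: for a quadruple `h` of the support of `γ = ℓ.loc N` and a slot `k`,
`‖(h_k · cf k)(x_k)‖ ≤ heckeSize (h_k) · (C · q₃^N · m (x_k))`. -/
theorem norm_heckeAct_slot_le (D : X.ThetaData) {K : X.Level} (γ : X.TrZ K →₀ ℂ)
    {m : (Fin 3 → X.E) → ℝ} {C q₃ : ℝ} {N : ℕ}
    (hcf : ∀ j x, ‖D.cf j x‖ ≤ C * m x) (hC : 0 ≤ C)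
    (hmH : ∀ r, X.IsRepOf γ r → ∀ x, m (r *ᵥ x) ≤ q₃ ^ N * m x)
    {h : X.TrZ K} (hh : h ∈ γ.support) (k : Fin 4) (x : X.Tuple) :
    ‖X.heckeAct (h.1 (X.slot k)) (D.cf k) (x k)‖ ≤
      heckeSize (h.1 (X.slot k)) * (C * q₃ ^ N * m (x k)) := by
  refine X.norm_heckeAct_le _ _ _ fun t ht r hr => ?_
  calc ‖D.cf k (r *ᵥ x k)‖ ≤ C * m (r *ᵥ x k) := hcf k _
    _ ≤ C * (q₃ ^ N * m (x k)) :=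
        mul_le_mul_of_nonneg_left (hmH r ⟨h, hh, k, t, ht, hr⟩ (x k)) hC
    _ = C * q₃ ^ N * m (x k) := by ring

/-- **The coefficient of a combination is bounded by its ℓ¹-size**: `‖coefQ cf γ x‖ ≤ trSize γ · (C q₃^N)⁴ ·
∏_k m (x_k)` under the slot bounds. -/
theorem norm_coefQ_le_trSize (D : X.ThetaData) {K : X.Level} (γ : X.TrZ K →₀ ℂ)
    {m : (Fin 3 → X.E) → ℝ} {C q₃ : ℝ} {N : ℕ}
    (hm0 : ∀ x, 0 ≤ m x) (hcf : ∀ j x, ‖D.cf j x‖ ≤ C * m x) (hC : 0 ≤ C) (hq₃ : 0 ≤ q₃)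
    (hmH : ∀ r, X.IsRepOf γ r → ∀ x, m (r *ᵥ x) ≤ q₃ ^ N * m x) (x : X.Tuple) :
    ‖X.coefQ D.cf γ x‖ ≤ X.trSize γ * ((C * q₃ ^ N) ^ 4 * ∏ k, m (x k)) := by
  unfold coefQ trSize Finsupp.sum
  refine (norm_sum_le _ _).trans ?_
  rw [Finset.sum_mul]
  refine Finset.sum_le_sum fun h hh => ?_
  dsimp only
  have hP : 0 ≤ C * q₃ ^ N := by positivity
  have h0 := X.norm_heckeAct_slot_le D γ hcf hC hmH hh 0 x
  have h1 := X.norm_heckeAct_slot_le D γ hcf hC hmH hh 1 x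
  have h2 := X.norm_heckeAct_slot_le D γ hcf hC hmH hh 2 x
  have h3 := X.norm_heckeAct_slot_le D γ hcf hC hmH hh 3 x
  have hS0 := heckeSize_nonneg (h.1 (X.slot 0))
  have hS1 := heckeSize_nonneg (h.1 (X.slot 1))
  have hS2 := heckeSize_nonneg (h.1 (X.slot 2))
  have hS3 := heckeSize_nonneg (h.1 (X.slot 3))
  have hm0' := hm0 (x 0)
  have hm1' := hm0 (x 1)
  have hm2' := hm0 (x 2)
  have hm3' := hm0 (x 3)
  have hA0 : 0 ≤ heckeSize (h.1 (X.slot 0)) * (C * q₃ ^ N * m (x 0)) := mul_nonneg hS0 (mul_nonneg hP hm0')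
  have hA1 : 0 ≤ heckeSize (h.1 (X.slot 1)) * (C * q₃ ^ N * m (x 1)) := mul_nonneg hS1 (mul_nonneg hP hm1')
  have hA2 : 0 ≤ heckeSize (h.1 (X.slot 2)) * (C * q₃ ^ N * m (x 2)) := mul_nonneg hS2 (mul_nonneg hP hm2')
  have hA3 : 0 ≤ heckeSize (h.1 (X.slot 3)) * (C * q₃ ^ N * m (x 3)) := mul_nonneg hS3 (mul_nonneg hP hm3')
  rw [norm_mul, norm_mul, norm_mul, Complex.norm_conj, norm_mul]
  rw [Fin.prod_univ_four]
  calc ‖γ h‖ *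
        (‖X.heckeAct (h.1 (X.slot 0)) (D.cf 0) (x 0)‖ * ‖X.heckeAct (h.1 (X.slot 1)) (D.cf 1) (x 1)‖) *
        (‖X.heckeAct (h.1 (X.slot 2)) (D.cf 2) (x 2)‖ * ‖X.heckeAct (h.1 (X.slot 3)) (D.cf 3) (x 3)‖)
      ≤ ‖γ h‖ * ((heckeSize (h.1 (X.slot 0)) * (C * q₃ ^ N * m (x 0))) *
          (heckeSize (h.1 (X.slot 1)) * (C * q₃ ^ N * m (x 1)))) *
        ((heckeSize (h.1 (X.slot 2)) * (C * q₃ ^ N * m (x 2))) *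
          (heckeSize (h.1 (X.slot 3)) * (C * q₃ ^ N * m (x 3)))) :=
        mul_le_mul (mul_le_mul_of_nonneg_left (mul_le_mul h0 h1 (norm_nonneg _) hA0) (norm_nonneg _))
          (mul_le_mul h2 h3 (norm_nonneg _) hA2) (mul_nonneg (norm_nonneg _) (norm_nonneg _))
          (mul_nonneg (norm_nonneg _) (mul_nonneg hA0 hA1))
    _ = ‖γ h‖ * (heckeSize (h.1 (X.slot 0)) * heckeSize (h.1 (X.slot 1)) *
          (heckeSize (h.1 (X.slot 2)) * heckeSize (h.1 (X.slot 3)))) *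
        ((C * q₃ ^ N) ^ 4 * (m (x 0) * m (x 1) * m (x 2) * m (x 3))) := by ring

/-- **The product of the majorants at the slots is dominated by the quadruple majorant at any `Γ⁴`-translate times
the definite Gaussian at the point** (`Γ`-invariance of `m`, the archimedean clause, the Gaussian split and the
reverse comparability), with `c₀ = c₁ / (2R)`. -/
theorem prod_majorant_le_quadMaj {m : (Fin 3 → X.E) → ℝ} {e c₁ : ℝ} (hc₁ : 0 < c₁)
    (hm0 : ∀ x, 0 ≤ m x) (hmΓ : ∀ γ ∈ X.Γ, ∀ x, m (γ *ᵥ x) = m x)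
    (hmA : ∀ x, m x ≤ (1 + ‖X.ballCoord x‖) ^ e * X.gaussDefAt c₁ x)
    {R : ℝ} (hR1 : 1 ≤ R)
    (hR : ∀ σ : X.E →+* ℂ, σ ≠ X.τ₀ → σ ≠ conjEmb X.τ₀ →
      ∀ γ : Matrix (Fin 3) (Fin 3) X.E, IsUnitaryOf X.c X.H γ → ∀ x : Fin 3 → X.E,
        ∑ i, ‖σ (x i)‖ ^ 2 ≤ R * ∑ i, ‖σ ((γ *ᵥ x) i)‖ ^ 2)
    (x : X.Tuple) (g : Fin 4 → X.Γ) :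
    ∏ k, m (x k) ≤ X.quadMaj e (c₁ / (2 * R)) x g * ∏ k, X.gaussDefAt (c₁ / (2 * R)) (x k) := by
  have hRpos : 0 < R := zero_lt_one.trans_le hR1
  unfold quadMaj
  rw [← Finset.prod_mul_distrib]
  refine Finset.prod_le_prod (fun k _ => hm0 _) fun k _ => ?_
  have hγ : IsUnitaryOf X.c X.H (g k).1 := X.isUnitaryOf_of_mem_Γ (g k).2
  have hc₀ : c₁ / (2 * R) ≤ c₁ / 2 := by
    apply div_le_div_of_nonneg_left hc₁.le (by positivity)
    linarith
  have hsplit : X.gaussDefAt c₁ ((g k).1 *ᵥ x k) =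
      X.gaussDefAt (c₁ / 2) ((g k).1 *ᵥ x k) * X.gaussDefAt (c₁ / 2) ((g k).1 *ᵥ x k) :=
    (X.gaussDefAt_half_mul_self c₁ _).symm
  have hback : X.gaussDefAt (c₁ / 2) ((g k).1 *ᵥ x k) ≤ X.gaussDefAt (c₁ / (2 * R)) (x k) := by
    have := X.gaussDefAt_mulVec_le hRpos hR (by positivity : 0 ≤ c₁ / 2) hγ (x k)
    rwa [div_div] at this
  have hanti : X.gaussDefAt (c₁ / 2) ((g k).1 *ᵥ x k) ≤ X.gaussDefAt (c₁ / (2 * R)) ((g k).1 *ᵥ x k) :=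
    X.gaussDefAt_anti hc₀ _
  have hpoly : 0 ≤ (1 + ‖X.ballCoord ((g k).1 *ᵥ x k)‖) ^ e := by positivity
  have hg1 : 0 ≤ X.gaussDefAt (c₁ / 2) ((g k).1 *ᵥ x k) := X.gaussDefAt_nonneg _ _
  have hg2 : 0 ≤ X.gaussDefAt (c₁ / (2 * R)) ((g k).1 *ᵥ x k) := X.gaussDefAt_nonneg _ _
  calc m (x k) = m ((g k).1 *ᵥ x k) := (hmΓ _ (g k).2 _).symm
    _ ≤ (1 + ‖X.ballCoord ((g k).1 *ᵥ x k)‖) ^ e * X.gaussDefAt c₁ ((g k).1 *ᵥ x k) := hmA _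
    _ = (1 + ‖X.ballCoord ((g k).1 *ᵥ x k)‖) ^ e *
          (X.gaussDefAt (c₁ / 2) ((g k).1 *ᵥ x k) * X.gaussDefAt (c₁ / 2) ((g k).1 *ᵥ x k)) := by
        rw [hsplit]
    _ ≤ (1 + ‖X.ballCoord ((g k).1 *ᵥ x k)‖) ^ e *
          (X.gaussDefAt (c₁ / (2 * R)) ((g k).1 *ᵥ x k) * X.gaussDefAt (c₁ / (2 * R)) (x k)) :=
        mul_le_mul_of_nonneg_left (mul_le_mul hanti hback hg1 hg2) hpoly
    _ = X.slotMaj e (c₁ / (2 * R)) ((g k).1 *ᵥ x k) * X.gaussDefAt (c₁ / (2 * R)) (x k) := by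
        unfold slotMaj
        ring

/-- **THE `Γ`-INVARIANT GROWTH CLAUSE FROM A MAJORANT OF THE THETA COEFFICIENTS AND THE SIZE OF THE LOCALISER.**
`LocSize ℓ → HasCoefMajorant D ℓ → GrowthInv D p L₀ xm ℓ`, with `B = B_size · C⁴`, `q₂ = q_size · q₃⁴`, the
exponent `e` of the majorant and `c₀ = c₁ / (2R)`, `R` the uniform reverse comparability constant of `U(H)` at the
definite embeddings. -/
theorem growthInv_of_coefMajorant (D : X.ThetaData)
    {p : IsDedekindDomain.HeightOneSpectrum (RingOfIntegers X.E)}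
    {L₀ : Submodule (RingOfIntegers X.E) (Fin 3 → X.E)} {xm : X.Tuple} (ℓ : X.LocS D p L₀ xm)
    (hsize : X.LocSize D ℓ) (hmaj : X.HasCoefMajorant D ℓ) : X.GrowthInv D p L₀ xm ℓ := by
  obtain ⟨Bs, qs, hBs, hqs, hsz⟩ := hsize
  obtain ⟨m, C, q₃, e, c₁, hC, hq₃, hc₁, hm0, hcf, hmΓ, hmH, hmA⟩ := hmaj
  obtain ⟨R, hR1, hR⟩ := X.exists_uniform_comparability_rev
  have hRpos : 0 < R := zero_lt_one.trans_le hR1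
  refine ⟨Bs * C ^ 4, qs * q₃ ^ 4, e, c₁ / (2 * R), by positivity, by positivity, fun N w g => ?_⟩
  have hmain := X.norm_coefQ_le_trSize D (ℓ.loc N) hm0 hcf hC hq₃ (hmH N) (X.rep w)
  have hprod := X.prod_majorant_le_quadMaj hc₁ hm0 hmΓ hmA hR1 hR (X.rep w) g
  have hP4 : 0 ≤ (C * q₃ ^ N) ^ 4 := by positivity
  have hQ : 0 ≤ X.quadMaj e (c₁ / (2 * R)) (X.rep w) g := X.quadMaj_nonneg _ _ _ _
  have hG : 0 ≤ ∏ k, X.gaussDefAt (c₁ / (2 * R)) (X.rep w k) :=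
    Finset.prod_nonneg fun k _ => X.gaussDefAt_nonneg _ _
  have hprod0 : 0 ≤ ∏ k, m (X.rep w k) := Finset.prod_nonneg fun k _ => hm0 _
  calc ‖X.coefQ D.cf (ℓ.loc N) (X.rep w)‖
      ≤ X.trSize (ℓ.loc N) * ((C * q₃ ^ N) ^ 4 * ∏ k, m (X.rep w k)) := hmain
    _ ≤ (Bs * qs ^ N) * ((C * q₃ ^ N) ^ 4 *
          (X.quadMaj e (c₁ / (2 * R)) (X.rep w) g * ∏ k, X.gaussDefAt (c₁ / (2 * R)) (X.rep w k))) :=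
        mul_le_mul (hsz N) (mul_le_mul_of_nonneg_left hprod hP4) (mul_nonneg hP4 hprod0)
          (mul_nonneg hBs (pow_nonneg hqs N))
    _ = Bs * C ^ 4 * (qs * q₃ ^ 4) ^ N * X.quadMaj e (c₁ / (2 * R)) (X.rep w) g *
          ∏ k, X.gaussDefAt (c₁ / (2 * R)) (X.rep w k) := by
        rw [mul_pow, mul_pow, ← pow_mul, ← pow_mul, mul_comm 4 N]
        ring

/-- **L3.5 FROM THE TWO CLAUSES AND `hlit`**: the summable majorant of the off-main orbital terms, uniform in the
depth, from the size clause of the localiser, a majorant of the theta coefficients and the Borel–Harish-Chandra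
fundamental domain (the only displayed printed input of the route). -/
theorem term_dominated_of_coefMajorant_lit (D : X.ThetaData)
    (p : IsDedekindDomain.HeightOneSpectrum (RingOfIntegers X.E))
    (L₀ : Submodule (RingOfIntegers X.E) (Fin 3 → X.E)) (xm : X.Tuple)
    (h02 : xm 2 = xm 0) (h13 : xm 3 = xm 1) (hab : LinearIndependent X.E ![xm 0, xm 1]) (ℓ : X.LocS D p L₀ xm)
    (hsize : X.LocSize D ℓ) (hmaj : X.HasCoefMajorant D ℓ)
    (hlit : Lit.BorelHarishChandra1962_Thm11_8_fundamentalDomain_hdef X.E X.H X.τ₀ X.C) :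
    ∃ bound : X.Orbit → ℝ, (∀ o, 0 ≤ bound o) ∧ Summable bound ∧
      ∀ N (o : X.Orbit), o ≠ X.orbitOf (X.lines xm) →
        ‖X.term D.Φ D.cf (ℓ.level N) (ℓ.loc N) o‖ ≤ bound o :=
  X.term_dominated_of_growthInv_lit D p L₀ xm h02 h13 hab ℓ (X.growthInv_of_coefMajorant D ℓ hsize hmaj) hlit

end T4Data

end Summit.Ventures.HodgeRepro.Tier4.Line3

end
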